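import Summits.KontsevichZagierPeriods.KontsevichZagierPeriods.Theorems.SymplecticScissorsRealOnePeriodRelationsStubRetractionPaths
import Summits.KontsevichZagierPeriods.KontsevichZagierPeriods.Theorems.HermiteRigidityGenusTwoCycleTransferPushforwardDimOne
import Summits.KontsevichZagierPeriods.KontsevichZagierPeriods.Theorems.HermiteRigidityGenusTwoCycleTransferSemialgebraicInvFunOn
import Literature.NumberTheory.Transcendental.KZCalculusProofs

/-!
# `RealOnePeriodRelations` (stmt-KontsevichZagierPeriods-10042), line `nash-retraction-thin-strip`:
# concatenation of paths in the move world — auxiliary file (reparametrisation and splitting)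

First half of the helper file `…StubRetractionConcat` for the stub `stub_retraction` (split off to
respect the file-size limit). The retraction `Θ` kills Huber–Wüstholz's boundary relation (R5)
`(Z, ω, e₀₁) + (Z, ω, e₁₂) − (Z, ω, e₀₂) ∼ 0` of a triangle by passing through the `C¹`
CONCATENATION `e₀₁ ⋆ e₁₂` (`CurvePeriods.CurvePath.concat`, glued with the flat cubic
`φ(t) = 3t² − 2t³`). This file provides the two move-world ingredients of
`[∫ along γ₁ ⋆ γ₂] ≡ [∫ along γ₁] + [∫ along γ₂] (mod M₁)`:

* §1 ONE rule-2 instance (`stub_pushforwardDimOne`): a strictly increasing semialgebraic `C¹`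
  reparametrisation `φ : (p,q) → (0,1)` turns a realisation along `γ ∘ φ` on `(p,q)` into a
  realisation along `γ` on `(0,1)`; the two halves `φ(2t)` on `(0,1/2)` and `φ(2t − 1)` on
  `(1/2,1)` of the unit interval (semialgebraicity, derivatives, images);
* §2 rule 1a: `[r] ≡ [r|_(0,1/2)] + [r|_(1/2,1)] (mod M₁)` (the middle point `{1/2}` is null).

References: M. Kontsevich, D. Zagier, *Periods* (2001), §1.2; A. Huber, G. Wüstholz,
*Transcendence and Linear Relations of 1-Periods* (2022), §3.3.1.
-/

noncomputable section

open scoped BigOperators unitInterval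
open Set MeasureTheory MvPolynomial
open Literature.NumberTheory.Transcendental Literature.NumberTheory.Transcendental.CurvePeriods
open Literature.ModelTheory.ExponentialFields (IsSemialgebraic)
open Summit.KontsevichZagierPeriods.SymplecticScissors.RealOnePeriodRelationsNegative (M₁ unitDom)
open Summit.KontsevichZagierPeriods.HermiteRigidity.GenusTwoCycleTransfer (stub_pushforwardDimOne
  stub_semialgebraicInvFunOn)

namespace Summit.KontsevichZagierPeriods.SymplecticScissors.RealOnePeriodRelations

namespace RetractionConcat

variable {Z : CurveData}

/-! ## §1 Reparametrising a piece of the unit interval -/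

/-- **A strictly increasing semialgebraic `C¹` reparametrisation of an open interval onto `(0,1)` is
ONE rule-2 instance.** Let `φ` have derivative `φ′ > 0` on `(p, q)` (both
`ℚ`-semialgebraic there) and `φ((p,q)) = (0,1)`; let `γ` be a `C¹` path and `κ` a function with
`κ(u) = γ(φ(u))` on `(p,q)`. Then the representation on `(p,q)` with integrand
`Re(b Σᵢ ωᵢ(κ(u)) κᵢ′(u))` and a realisation of `b·(Z, ω, γ)` on `(0,1)` are congruent modulo `M₁`
(the chain rule makes the first integrand `φ′(u)` times the second at `φ(u)`).
[cite: KontsevichZagier2001, §1.2 rule (2)] -/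
theorem reparam_move {p q : ℝ} (φ φ' : ℝ → ℝ)
    (hφ : IsSemialgebraicFunOn ℚ {z : Fin 1 → ℝ | z 0 ∈ Set.Ioo p q} (fun z => φ (z 0)))
    (hφ' : IsSemialgebraicFunOn ℚ {z : Fin 1 → ℝ | z 0 ∈ Set.Ioo p q} (fun z => φ' (z 0)))
    (hder : ∀ t ∈ Set.Ioo p q, HasDerivAt φ (φ' t) t) (hpos : ∀ t ∈ Set.Ioo p q, 0 < φ' t)
    (himage : φ '' Set.Ioo p q = Set.Ioo 0 1)
    (γ : CurvePath Z) (ω : Fin Z.n → MvPolynomial (Fin Z.n) ℂ) (b : ℂ) (κ : ℝ → (Fin Z.n → ℂ))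
    (hκ : ∀ u ∈ Set.Ioo p q, κ u = γ.toFun (φ u))
    (rP r₁ : KZ.IntegralRep 1) (hrPdom : rP.domain = {z | z 0 ∈ Set.Ioo p q})
    (hrP : ∀ z ∈ rP.domain, rP.integrand z =
      (b * ∑ i, MvPolynomial.eval (κ (z 0)) (ω i) * deriv (fun u => κ u i) (z 0)).re)
    (hr₁ : r₁.domain = {z | z 0 ∈ Set.Ioo (0 : ℝ) 1} ∧ ∀ z ∈ r₁.domain, r₁.integrand z =
      (b * ∑ i, MvPolynomial.eval (γ.toFun (z 0)) (ω i) * deriv (fun u => γ.toFun u i) (z 0)).re) :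
    KZ.of rP - KZ.of r₁ ∈ M₁ := by
  -- injectivity of `Φ : z ↦ (φ (z 0))` on the piece
  set Φ : (Fin 1 → ℝ) → (Fin 1 → ℝ) := fun z _ => φ (z 0) with hΦ
  have hmono : StrictMonoOn φ (Set.Ioo p q) := by
    refine strictMonoOn_of_deriv_pos (convex_Ioo p q)
      (fun t ht => (hder t ht).continuousAt.continuousWithinAt) fun t ht => ?_
    rw [interior_Ioo] at ht
    rw [(hder t ht).deriv]
    exact hpos t ht
  have hinj : InjOn Φ rP.domain := by
    intro x hx y hy hxy
    rw [hrPdom] at hx hy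
    have h := congr_fun hxy 0
    simp only [hΦ] at h
    have := hmono.injOn hx hy h
    funext i
    rw [Fin.fin_one_eq_zero i]
    exact this
  -- the semialgebraic left inverse
  have hΦsa : IsSemialgebraicMapOn ℚ rP.domain Φ :=
    IsSemialgebraicMapOn.of_forall rP.isSemialgebraic_domain fun _ => hrPdom ▸ hφ
  have hG := stub_semialgebraicInvFunOn hΦsa hinj
  have hGφ : ∀ z ∈ rP.domain, Function.invFunOn Φ rP.domain (fun _ => φ (z 0)) = z :=
    fun z hz => hinj.leftInvOn_invFunOn hz
  -- rule 2
  obtain ⟨s, hsdom, hsint, hrel⟩ := stub_pushforwardDimOne rP φ φ' (Function.invFunOn Φ rP.domain)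
    (hrPdom ▸ hφ) (hrPdom ▸ hφ') (fun z hz => hder _ (by rw [hrPdom] at hz; exact hz))
    (fun z hz => (hpos _ (by rw [hrPdom] at hz; exact hz)).ne') hG hGφ
  -- the image is the unit interval
  have hsdom' : s.domain = {z | z 0 ∈ Set.Ioo (0 : ℝ) 1} := by
    rw [hsdom]
    ext x
    simp only [mem_image, mem_setOf_eq]
    constructor
    · rintro ⟨z, hz, rfl⟩
      rw [hrPdom] at hz
      have : φ (z 0) ∈ φ '' Set.Ioo p q := ⟨z 0, hz, rfl⟩
      rwa [himage] at this
    · intro hx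
      have hx' : x 0 ∈ φ '' Set.Ioo p q := by rw [himage]; exact hx
      obtain ⟨t, ht, hxt⟩ := hx'
      refine ⟨fun _ => t, by rw [hrPdom]; exact ht, ?_⟩
      funext i
      rw [Fin.fin_one_eq_zero i]
      exact hxt
  -- `s` and `r₁` have the same integrand on `(0,1)`
  have hs₁ : KZ.of s - KZ.of r₁ ∈ M₁ := by
    refine RetractionAlgebra.sub_mem_of_eqOn s r₁ (hsdom'.trans hr₁.1.symm) fun x hx => ?_
    rw [hsdom] at hx
    obtain ⟨z, hz, rfl⟩ := hx
    have hzI : z 0 ∈ Set.Ioo p q := by rw [hrPdom] at hz; exact hz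
    have hφz : φ (z 0) ∈ Set.Ioo (0 : ℝ) 1 := by
      have : φ (z 0) ∈ φ '' Set.Ioo p q := ⟨z 0, hzI, rfl⟩
      rwa [himage] at this
    rw [hsint z hz, hrP z hz, hr₁.2 _ (by rw [hr₁.1]; exact hφz)]
    -- chain rule for `κᵢ = γᵢ ∘ φ` near `z 0`
    have hchain : ∀ i, deriv (fun u => κ u i) (z 0) =
        (φ' (z 0) : ℂ) * deriv (fun u => γ.toFun u i) (φ (z 0)) := by
      intro i
      have h1 : HasDerivAt (fun u => γ.toFun (φ u) i)
          ((φ' (z 0)) • deriv (fun u => γ.toFun u i) (φ (z 0))) (z 0) :=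
        (γ.hasDerivAt hφz i).scomp (z 0) (hder _ hzI)
      have heq : (fun u => κ u i) =ᶠ[nhds (z 0)] fun u => γ.toFun (φ u) i := by
        filter_upwards [Ioo_mem_nhds hzI.1 hzI.2] with u hu
        rw [hκ u hu]
      rw [(h1.congr_of_eventuallyEq heq).deriv, Complex.real_smul]
    simp only [hchain, hκ _ hzI]
    have hpos' : 0 < φ' (z 0) := hpos _ hzI
    rw [abs_of_pos hpos']
    have hre : ∀ w : ℂ, (b * ((φ' (z 0) : ℂ) * w)).re = φ' (z 0) * (b * w).re := by
      intro w
      rw [show b * ((φ' (z 0) : ℂ) * w) = (φ' (z 0) : ℂ) * (b * w) by ring, Complex.re_ofReal_mul]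
    rw [show (∑ i, eval (γ.toFun (φ (z 0))) (ω i) * ((φ' (z 0) : ℂ) * deriv (fun u => γ.toFun u i) (φ (z 0)))) =
        (φ' (z 0) : ℂ) * ∑ i, eval (γ.toFun (φ (z 0))) (ω i) * deriv (fun u => γ.toFun u i) (φ (z 0)) by
      rw [Finset.mul_sum]; exact Finset.sum_congr rfl fun i _ => by ring, hre]
    field_simp
  have h := M₁.add_mem (RetractionAlgebra.mem_M₁_of_mem_changeOfVariablesRel hrel) hs₁
  rwa [sub_add_sub_cancel] at h

/-! ### The two halves of the unit interval -/

/-- `u ↦ φ(2u)` is a `ℚ`-semialgebraic function on any `ℚ`-semialgebraic subset of `ℝ¹`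
(a polynomial). [folklore] -/
theorem isSemialgebraicFunOn_smoothStep_two_mul {s : Set (Fin 1 → ℝ)} (hs : IsSemialgebraic ℚ s) :
    IsSemialgebraicFunOn ℚ s (fun z => smoothStep (2 * z 0)) :=
  (isSemialgebraicFunOn_aeval hs ((MvPolynomial.C 2 * MvPolynomial.X 0) * (MvPolynomial.C 2 * MvPolynomial.X 0) *
    (MvPolynomial.C 3 - MvPolynomial.C 2 * (MvPolynomial.C 2 * MvPolynomial.X 0)))).congr fun z _ => by
    simp [smoothStep]

/-- The derivative `24u(1 − 2u)` of `u ↦ φ(2u)` is `ℚ`-semialgebraic. [folklore] -/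
theorem isSemialgebraicFunOn_deriv_smoothStep_two_mul {s : Set (Fin 1 → ℝ)} (hs : IsSemialgebraic ℚ s) :
    IsSemialgebraicFunOn ℚ s (fun z => 6 * (2 * z 0) * (1 - 2 * z 0) * 2) :=
  (isSemialgebraicFunOn_aeval hs (MvPolynomial.C 6 * (MvPolynomial.C 2 * MvPolynomial.X 0) *
    (MvPolynomial.C 1 - MvPolynomial.C 2 * MvPolynomial.X 0) * MvPolynomial.C 2)).congr fun z _ => by
    simp

/-- `u ↦ φ(2u − 1)` is `ℚ`-semialgebraic. [folklore] -/
theorem isSemialgebraicFunOn_smoothStep_two_mul_sub_one {s : Set (Fin 1 → ℝ)}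
    (hs : IsSemialgebraic ℚ s) : IsSemialgebraicFunOn ℚ s (fun z => smoothStep (2 * z 0 - 1)) :=
  (isSemialgebraicFunOn_aeval hs ((MvPolynomial.C 2 * MvPolynomial.X 0 - MvPolynomial.C 1) *
    (MvPolynomial.C 2 * MvPolynomial.X 0 - MvPolynomial.C 1) *
    (MvPolynomial.C 3 - MvPolynomial.C 2 * (MvPolynomial.C 2 * MvPolynomial.X 0 - MvPolynomial.C 1)))).congr
    fun z _ => by simp [smoothStep]

/-- The derivative `12(2u−1)(2 − 2u)` of `u ↦ φ(2u − 1)` is `ℚ`-semialgebraic. [folklore] -/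
theorem isSemialgebraicFunOn_deriv_smoothStep_two_mul_sub_one {s : Set (Fin 1 → ℝ)}
    (hs : IsSemialgebraic ℚ s) :
    IsSemialgebraicFunOn ℚ s (fun z => 6 * (2 * z 0 - 1) * (1 - (2 * z 0 - 1)) * 2) :=
  (isSemialgebraicFunOn_aeval hs (MvPolynomial.C 6 * (MvPolynomial.C 2 * MvPolynomial.X 0 - MvPolynomial.C 1) *
    (MvPolynomial.C 1 - (MvPolynomial.C 2 * MvPolynomial.X 0 - MvPolynomial.C 1)) * MvPolynomial.C 2)).congr
    fun z _ => by simp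

/-- The open interval `{z | z 0 ∈ (p, q)} ⊂ ℝ¹` with rational end points is `ℚ`-semialgebraic.
[folklore] -/
theorem isSemialgebraic_Ioo (p q : ℚ) :
    IsSemialgebraic ℚ {z : Fin 1 → ℝ | z 0 ∈ Set.Ioo (p : ℝ) q} := by
  have h1 := Literature.ModelTheory.ExponentialFields.isSemialgebraic_setOf_eval_pos (k := ℚ) (R := ℝ)
    (MvPolynomial.X (0 : Fin 1) - MvPolynomial.C p : MvPolynomial (Fin 1) ℚ)
  have h2 := Literature.ModelTheory.ExponentialFields.isSemialgebraic_setOf_eval_pos (k := ℚ) (R := ℝ)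
    (MvPolynomial.C q - MvPolynomial.X (0 : Fin 1) : MvPolynomial (Fin 1) ℚ)
  have hset : {z : Fin 1 → ℝ | z 0 ∈ Set.Ioo (p : ℝ) q} =
      {x | 0 < MvPolynomial.aeval x (MvPolynomial.X (0 : Fin 1) - MvPolynomial.C p : MvPolynomial (Fin 1) ℚ)} ∩
      {x | 0 < MvPolynomial.aeval x (MvPolynomial.C q - MvPolynomial.X (0 : Fin 1) : MvPolynomial (Fin 1) ℚ)} := by
    ext z
    simp [sub_pos]
  rw [hset]
  exact h1.inter h2

/-- The singleton `{z | z 0 = 1/2} ⊂ ℝ¹` is `ℚ`-semialgebraic. [folklore] -/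
theorem isSemialgebraic_half : IsSemialgebraic ℚ {z : Fin 1 → ℝ | z 0 = 1 / 2} := by
  have h := Literature.ModelTheory.ExponentialFields.isSemialgebraic_setOf_eval_eq_zero (k := ℚ) (R := ℝ)
    (MvPolynomial.X (0 : Fin 1) - MvPolynomial.C (1 / 2 : ℚ) : MvPolynomial (Fin 1) ℚ)
  have hset : {z : Fin 1 → ℝ | z 0 = 1 / 2} =
      {x | MvPolynomial.aeval x (MvPolynomial.X (0 : Fin 1) - MvPolynomial.C (1 / 2 : ℚ) : MvPolynomial (Fin 1) ℚ) = 0} := by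
    ext z
    simp [sub_eq_zero]
  rw [hset]
  exact h

/-- `(φ(2u))′ = 6·(2u)(1 − 2u)·2`. [folklore] -/
theorem hasDerivAt_smoothStep_two_mul (t : ℝ) :
    HasDerivAt (fun u => smoothStep (2 * u)) (6 * (2 * t) * (1 - 2 * t) * 2) t := by
  have h2 : HasDerivAt (fun u : ℝ => 2 * u) 2 t := by
    simpa using (hasDerivAt_id t).const_mul (2 : ℝ)
  exact (hasDerivAt_smoothStep (2 * t)).comp t h2

/-- `(φ(2u − 1))′ = 6·(2u−1)(1 − (2u−1))·2`. [folklore] -/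
theorem hasDerivAt_smoothStep_two_mul_sub_one (t : ℝ) :
    HasDerivAt (fun u => smoothStep (2 * u - 1)) (6 * (2 * t - 1) * (1 - (2 * t - 1)) * 2) t := by
  have h2 : HasDerivAt (fun u : ℝ => 2 * u - 1) 2 t := by
    simpa using ((hasDerivAt_id t).const_mul (2 : ℝ)).sub_const 1
  exact (hasDerivAt_smoothStep (2 * t - 1)).comp t h2

/-- `φ(2·)` maps `(0, 1/2)` onto `(0,1)`. [folklore] -/
theorem image_smoothStep_two_mul : (fun u => smoothStep (2 * u)) '' Set.Ioo (0 : ℝ) (1 / 2) = Set.Ioo 0 1 := by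
  have hder : ∀ t, HasDerivAt (fun u => smoothStep (2 * u)) (6 * (2 * t) * (1 - 2 * t) * 2) t :=
    hasDerivAt_smoothStep_two_mul
  have hcont : Continuous fun u => smoothStep (2 * u) :=
    (contDiff_smoothStep (n := 1)).continuous.comp (continuous_const.mul continuous_id)
  have hmono : StrictMonoOn (fun u => smoothStep (2 * u)) (Set.Icc (0 : ℝ) (1 / 2)) := by
    refine strictMonoOn_of_deriv_pos (convex_Icc 0 (1 / 2)) hcont.continuousOn fun t ht => ?_
    rw [interior_Icc] at ht
    rw [(hder t).deriv]
    have h1 : 0 < 2 * t := by linarith [ht.1]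
    have h2 : 0 < 1 - 2 * t := by linarith [ht.2]
    positivity
  apply Subset.antisymm
  · rintro x ⟨t, ht, rfl⟩
    have h0 : smoothStep (2 * 0) < smoothStep (2 * t) :=
      hmono ⟨le_rfl, by norm_num⟩ ⟨ht.1.le, ht.2.le⟩ ht.1
    have h1 : smoothStep (2 * t) < smoothStep (2 * (1 / 2)) :=
      hmono ⟨ht.1.le, ht.2.le⟩ ⟨by norm_num, le_rfl⟩ ht.2
    rw [mul_zero, smoothStep_zero] at h0
    rw [show (2 : ℝ) * (1 / 2) = 1 by norm_num, smoothStep_one] at h1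
    exact ⟨h0, h1⟩
  · have h := intermediate_value_Ioo (by norm_num : (0 : ℝ) ≤ 1 / 2) hcont.continuousOn
    rw [mul_zero, smoothStep_zero, show (2 : ℝ) * (1 / 2) = 1 by norm_num, smoothStep_one] at h
    exact h

/-- `φ(2· − 1)` maps `(1/2, 1)` onto `(0,1)`. [folklore] -/
theorem image_smoothStep_two_mul_sub_one :
    (fun u => smoothStep (2 * u - 1)) '' Set.Ioo (1 / 2 : ℝ) 1 = Set.Ioo 0 1 := by
  have hder : ∀ t, HasDerivAt (fun u => smoothStep (2 * u - 1)) (6 * (2 * t - 1) * (1 - (2 * t - 1)) * 2) t :=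
    hasDerivAt_smoothStep_two_mul_sub_one
  have hcont : Continuous fun u => smoothStep (2 * u - 1) :=
    (contDiff_smoothStep (n := 1)).continuous.comp ((continuous_const.mul continuous_id).sub continuous_const)
  have hmono : StrictMonoOn (fun u => smoothStep (2 * u - 1)) (Set.Icc (1 / 2 : ℝ) 1) := by
    refine strictMonoOn_of_deriv_pos (convex_Icc (1 / 2) 1) hcont.continuousOn fun t ht => ?_
    rw [interior_Icc] at ht
    rw [(hder t).deriv]
    have h1 : 0 < 2 * t - 1 := by linarith [ht.1]
    have h2 : 0 < 1 - (2 * t - 1) := by linarith [ht.2]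
    positivity
  apply Subset.antisymm
  · rintro x ⟨t, ht, rfl⟩
    have h0 : smoothStep (2 * (1 / 2) - 1) < smoothStep (2 * t - 1) :=
      hmono ⟨le_rfl, by norm_num⟩ ⟨ht.1.le, ht.2.le⟩ ht.1
    have h1 : smoothStep (2 * t - 1) < smoothStep (2 * 1 - 1) :=
      hmono ⟨ht.1.le, ht.2.le⟩ ⟨by norm_num, le_rfl⟩ ht.2
    rw [show (2 : ℝ) * (1 / 2) - 1 = 0 by norm_num, smoothStep_zero] at h0
    rw [show (2 : ℝ) * 1 - 1 = 1 by norm_num, smoothStep_one] at h1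
    exact ⟨h0, h1⟩
  · have h := intermediate_value_Ioo (by norm_num : (1 / 2 : ℝ) ≤ 1) hcont.continuousOn
    rw [show (2 : ℝ) * (1 / 2) - 1 = 0 by norm_num, smoothStep_zero,
      show (2 : ℝ) * 1 - 1 = 1 by norm_num, smoothStep_one] at h
    exact h

/-! ## §2 Splitting the unit interval at `1/2` -/

/-- **Splitting a representation on `(0,1)` at `1/2`**: `[r] ≡ [r|_(0,1/2)] + [r|_(1/2,1)] (mod M₁)`
(rule 1a twice; the middle point is null). [cite: KontsevichZagier2001, §1.2 rule (1)] -/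
theorem split_half (r : KZ.IntegralRep 1) (hr : r.domain = {z | z 0 ∈ Set.Ioo (0 : ℝ) 1})
    (hA : {z : Fin 1 → ℝ | z 0 ∈ Set.Ioo (0 : ℝ) (1 / 2)} ⊆ r.domain)
    (hB : {z : Fin 1 → ℝ | z 0 ∈ Set.Ioo (1 / 2 : ℝ) 1} ⊆ r.domain) :
    KZ.of r - KZ.of (r.restrict {z : Fin 1 → ℝ | z 0 ∈ Set.Ioo (0 : ℝ) (1 / 2)}
        (by simpa using isSemialgebraic_Ioo 0 (1 / 2)) hA) -
      KZ.of (r.restrict {z : Fin 1 → ℝ | z 0 ∈ Set.Ioo (1 / 2 : ℝ) 1}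
        (by simpa using isSemialgebraic_Ioo (1 / 2) 1) hB) ∈ M₁ := by
  -- the three pieces
  have hP : {z : Fin 1 → ℝ | z 0 = 1 / 2} ⊆ r.domain := fun z hz => by
    rw [hr]
    simp only [mem_setOf_eq] at hz ⊢
    rw [hz]; norm_num
  have hAP : {z : Fin 1 → ℝ | z 0 ∈ Set.Ioo (0 : ℝ) (1 / 2)} ∪ {z : Fin 1 → ℝ | z 0 = 1 / 2} ⊆ r.domain :=
    Set.union_subset hA hP
  set rA := r.restrict {z : Fin 1 → ℝ | z 0 ∈ Set.Ioo (0 : ℝ) (1 / 2)}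
    (by simpa using isSemialgebraic_Ioo 0 (1 / 2)) hA with hrA
  set rB := r.restrict {z : Fin 1 → ℝ | z 0 ∈ Set.Ioo (1 / 2 : ℝ) 1}
    (by simpa using isSemialgebraic_Ioo (1 / 2) 1) hB with hrB
  set rP := r.restrict {z : Fin 1 → ℝ | z 0 = 1 / 2} isSemialgebraic_half hP with hrP
  set rAP := r.restrict ({z : Fin 1 → ℝ | z 0 ∈ Set.Ioo (0 : ℝ) (1 / 2)} ∪ {z : Fin 1 → ℝ | z 0 = 1 / 2})
    ((by simpa using isSemialgebraic_Ioo 0 (1 / 2) : IsSemialgebraic ℚ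
      {z : Fin 1 → ℝ | z 0 ∈ Set.Ioo (0 : ℝ) (1 / 2)}).union isSemialgebraic_half) hAP with hrAP
  -- `[r] − [rAP] − [rB]`
  have h1 : KZ.of r - KZ.of rAP - KZ.of rB ∈ M₁ := by
    refine RetractionAlgebra.mem_M₁_of_mem_domainAddRel ⟨1, r, rAP, rB, ?_, ?_, fun _ _ => rfl,
      fun _ _ => rfl, rfl⟩
    · rw [hr]
      ext z
      simp only [KZ.IntegralRep.domain_restrict, mem_setOf_eq, mem_union, mem_Ioo, rAP, rB]
      constructor
      · intro hz
        rcases lt_trichotomy (z 0) (1 / 2) with h | h | h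
        · exact Or.inl (Or.inl ⟨hz.1, h⟩)
        · exact Or.inl (Or.inr h)
        · exact Or.inr ⟨h, hz.2⟩
      · rintro ((⟨h1, h2⟩ | h) | ⟨h1, h2⟩)
        · exact ⟨h1, by linarith⟩
        · rw [h]; norm_num
        · exact ⟨by linarith, h2⟩
    · have he : rAP.domain ∩ rB.domain = ∅ := by
        ext z
        simp only [KZ.IntegralRep.domain_restrict, mem_inter_iff, mem_union, mem_setOf_eq, mem_Ioo,
          mem_empty_iff_false, iff_false, rAP, rB]
        rintro ⟨(⟨_, h2⟩ | h), ⟨h3, _⟩⟩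
        · linarith
        · linarith
      rw [he, measure_empty]
  -- `[rAP] − [rA] − [rP]`
  have h2 : KZ.of rAP - KZ.of rA - KZ.of rP ∈ M₁ := by
    refine RetractionAlgebra.mem_M₁_of_mem_domainAddRel ⟨1, rAP, rA, rP, rfl, ?_, fun _ _ => rfl,
      fun _ _ => rfl, rfl⟩
    have he : rA.domain ∩ rP.domain = ∅ := by
      ext z
      simp only [KZ.IntegralRep.domain_restrict, mem_inter_iff, mem_setOf_eq, mem_Ioo,
        mem_empty_iff_false, iff_false, rA, rP]
      rintro ⟨⟨_, h2⟩, h⟩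
      linarith
    rw [he, measure_empty]
  -- `[rP] ∈ M₁`
  have h3 : KZ.of rP ∈ M₁ := by
    refine HomotopyInvariance.of_mem_of_volume_zero rP ?_
    have hsub : rP.domain ⊆ {fun _ : Fin 1 => (1 / 2 : ℝ)} := fun z hz => by
      simp only [KZ.IntegralRep.domain_restrict, mem_setOf_eq, rP] at hz
      rw [mem_singleton_iff]
      funext i
      rw [Fin.fin_one_eq_zero i, hz]
    exact measure_mono_null hsub (measure_singleton _)
  have h := M₁.add_mem (M₁.add_mem h1 h2) h3
  have he : KZ.of r - KZ.of rAP - KZ.of rB + (KZ.of rAP - KZ.of rA - KZ.of rP) + KZ.of rP =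
      KZ.of r - KZ.of rA - KZ.of rB := by abel
  rwa [he] at h

end RetractionConcat

/-- HELPER ANCHOR of this file (registered on stmt-KontsevichZagierPeriods-10042): the middle point
`{z | z 0 = 1/2} ⊂ ℝ¹` of the unit interval is `ℚ`-semialgebraic. [folklore] -/
theorem helper_retractionConcatAux_half : Literature.ModelTheory.ExponentialFields.IsSemialgebraic ℚ {z : Fin 1 → ℝ | z 0 = 1 / 2} :=
  RetractionConcat.isSemialgebraic_half

end Summit.KontsevichZagierPeriods.SymplecticScissors.RealOnePeriodRelations

end
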